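import Mathlib
import HarnessLib
import Summits.HubbardSuperconductivity.HubbardSuperconductivity.Theorems.KLProgrammeKLRegimeCountertermMuFlow

/-!
# Route `KLProgramme`, crux K3 — gen-8 ENGINE-FLOW child (stmt-HubbardSuperconductivity-20437 `KLRegimeEngineV17F2`), stub (C)
# `stub_twoLeg_curvature`: the SHARP mean-free sup from the slope — `|g(t) − mean g| ≤ (π/2)·sup|g′|`

Seat hubbard-kl-k3c3-p1 (g8; row «δμ-flow with klAngularMean constant piece»).  The (C1) certificate's dominant row at the first reading
scale is `a₀·N₄` with `a₀` = the MEAN-FREE sup of the scale-`n` reading `ν_n(K_n)` (the constant piece rides the δμ-flow and never enters the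
Jackson remainder): the located condition of record is `a₀(ν₀) ≲ 0.21·U²` (`C1-CERT.md` §6, KL STATUS (R79d)).  The closer gets `a₀` from the
SLOPE of the reading (`O(U²)`), not from its `O(|U|)` sup; the tree's `abs_sub_klAngularMean_le_of_deriv` (`…SplitTwoLegIncrementSizes`) gives
`|g − mean g| ≤ 2π·Λ`.  This file proves the SHARP constant `π/2` (attained by the triangle wave): for a differentiable `2π`-periodic `g` with
`|g′| ≤ Λ`, integrating the Lipschitz cone `g(t) − Λ|x − t| ≤ g(x) ≤ g(t) + Λ|x − t|` over the period `[t − π, t + π]` gives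
`|2π·g(t) − ∫g| ≤ Λ·π²`, i.e. **`|g(t) − mean g| ≤ (π/2)·Λ`** (`abs_sub_klAngularMean_le_half_pi_mul_of_deriv`) — a factor `4` on the `a₀`
input of `readResidueC1_jets_of_certFrame(_klEng)` (`…JacksonRemainderReadResidueC1`).

Pure real analysis; no definitions; nothing here asserts superconductivity.
-/

noncomputable section

namespace Summit.HubbardSuperconductivity.HubbardSuperconductivity.Theorems.KLRegimeSplit

set_option linter.dupNamespace false -- summit = problem name (single-conjunct summit), D-0017

open Real MeasureTheory intervalIntegral

/-- `∫_{t−π}^{t+π} |x − t| dx = π²`. -/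
theorem integral_abs_sub_over_period (t : ℝ) : ∫ x in (t - π)..(t + π), |x - t| = π ^ 2 := by
  have hπ := Real.pi_pos
  have hleft : ∫ x in (t - π)..t, |x - t| = π ^ 2 / 2 := by
    have e : ∫ x in (t - π)..t, |x - t| = ∫ x in (t - π)..t, (t - x) := by
      refine integral_congr fun x hx => ?_
      rw [Set.uIcc_of_le (by linarith)] at hx
      rw [abs_of_nonpos (by linarith [hx.2])]
      ring
    rw [e, integral_sub intervalIntegrable_const intervalIntegral.intervalIntegrable_id, intervalIntegral.integral_const, integral_id]
    simp only [smul_eq_mul]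
    ring
  have hright : ∫ x in t..(t + π), |x - t| = π ^ 2 / 2 := by
    have e : ∫ x in t..(t + π), |x - t| = ∫ x in t..(t + π), (x - t) := by
      refine integral_congr fun x hx => ?_
      rw [Set.uIcc_of_le (by linarith)] at hx
      rw [abs_of_nonneg (by linarith [hx.1])]
    rw [e, integral_sub intervalIntegral.intervalIntegrable_id intervalIntegrable_const, intervalIntegral.integral_const, integral_id]
    simp only [smul_eq_mul]
    ring
  have hc : Continuous fun x : ℝ => |x - t| := by fun_prop
  rw [← integral_add_adjacent_intervals (hc.intervalIntegrable _ _) (hc.intervalIntegrable _ _), hleft, hright]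
  ring

/-- **The sharp mean-free sup from the slope.**  A differentiable `2π`-periodic `g` with `|g′| ≤ Λ` satisfies
`|g(t) − mean g| ≤ (π/2)·Λ` at every `t` (`mean g = (2π)⁻¹∫₀^{2π} g`; the constant `π/2` is attained by the triangle wave). -/
theorem abs_sub_klAngularMean_le_half_pi_mul_of_deriv {g : ℝ → ℝ} (hg : Differentiable ℝ g) (hper : Function.Periodic g (2 * π))
    {Λ : ℝ} (hΛ : ∀ θ, |deriv g θ| ≤ Λ) (t : ℝ) : |g t - klAngularMean g| ≤ π / 2 * Λ := by
  have hπ := Real.pi_pos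
  have hlip : ∀ x y : ℝ, |g x - g y| ≤ Λ * |x - y| := by
    intro x y
    have h := Convex.norm_image_sub_le_of_norm_deriv_le (f := g) (s := Set.univ) (fun z _ => hg.differentiableAt)
      (fun z _ => by rw [Real.norm_eq_abs]; exact hΛ z) convex_univ (Set.mem_univ y) (Set.mem_univ x)
    simpa [Real.norm_eq_abs] using h
  have hcont : Continuous g := hg.continuous
  -- the integral over the period `[t − π, t + π]` is `2π·mean g`
  have hI : ∫ x in (t - π)..(t + π), g x = 2 * π * klAngularMean g := by
    have h1 := hper.intervalIntegral_add_eq (t - π) 0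
    have e1 : t - π + 2 * π = t + π := by ring
    rw [e1, zero_add] at h1
    rw [h1, klAngularMean_def]
    field_simp
  have hJ := integral_abs_sub_over_period t
  have hcone : Continuous fun x : ℝ => |x - t| := by fun_prop
  have hconeΛ : Continuous fun x : ℝ => Λ * |x - t| := by fun_prop
  have hab : t - π ≤ t + π := by linarith
  -- lower cone
  have hlo : ∫ x in (t - π)..(t + π), (g t - Λ * |x - t|) ≤ ∫ x in (t - π)..(t + π), g x := by
    refine integral_mono_on hab ((continuous_const.sub hconeΛ).intervalIntegrable _ _) (hcont.intervalIntegrable _ _) fun x _ => ?_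
    have h := hlip t x
    rw [abs_sub_comm t x] at h
    linarith [(abs_le.1 h).2]
  -- upper cone
  have hhi : ∫ x in (t - π)..(t + π), g x ≤ ∫ x in (t - π)..(t + π), (g t + Λ * |x - t|) := by
    refine integral_mono_on hab (hcont.intervalIntegrable _ _) ((continuous_const.add hconeΛ).intervalIntegrable _ _) fun x _ => ?_
    have h := hlip x t
    linarith [(abs_le.1 h).2]
  have elo : ∫ x in (t - π)..(t + π), (g t - Λ * |x - t|) = 2 * π * g t - Λ * π ^ 2 := by
    rw [integral_sub intervalIntegrable_const (hconeΛ.intervalIntegrable _ _), intervalIntegral.integral_const,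
      intervalIntegral.integral_const_mul, hJ]
    simp only [smul_eq_mul]
    ring
  have ehi : ∫ x in (t - π)..(t + π), (g t + Λ * |x - t|) = 2 * π * g t + Λ * π ^ 2 := by
    rw [integral_add intervalIntegrable_const (hconeΛ.intervalIntegrable _ _), intervalIntegral.integral_const,
      intervalIntegral.integral_const_mul, hJ]
    simp only [smul_eq_mul]
    ring
  rw [elo, hI] at hlo
  rw [ehi, hI] at hhi
  have h2π : (0 : ℝ) < 2 * π := by positivity
  rw [abs_le]
  constructor
  · -- `mean g − g t ≤ (π/2)Λ` from the upper cone
    have key : 2 * π * (klAngularMean g - g t) ≤ 2 * π * (π / 2 * Λ) := by linarith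
    have h2 := le_of_mul_le_mul_left key h2π
    linarith
  · have key : 2 * π * (g t - klAngularMean g) ≤ 2 * π * (π / 2 * Λ) := by linarith
    exact le_of_mul_le_mul_left key h2π

/-- The same with `iteratedDeriv 1` (the currency of the (C1) consumers' size tables): `|∂¹g| ≤ a₁` ⇒ `|g(t) − mean g| ≤ (π/2)·a₁`. -/
theorem abs_sub_klAngularMean_le_half_pi_mul_of_iteratedDeriv_one {g : ℝ → ℝ} (hg : Differentiable ℝ g)
    (hper : Function.Periodic g (2 * π)) {a₁ : ℝ} (ha₁ : ∀ θ, |iteratedDeriv 1 g θ| ≤ a₁) (t : ℝ) :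
    |g t - klAngularMean g| ≤ π / 2 * a₁ :=
  abs_sub_klAngularMean_le_half_pi_mul_of_deriv hg hper (fun θ => by simpa only [iteratedDeriv_one] using ha₁ θ) t

end Summit.HubbardSuperconductivity.HubbardSuperconductivity.Theorems.KLRegimeSplit

end
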